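import Mathlib.Analysis.Convex.Deriv
import Literature.MathematicalPhysics.QuantumLattice.HubbardNNNHoppingEnergyDensityConcave
import Literature.MathematicalPhysics.QuantumLattice.HubbardNNNHoppingEnergyDensityMonotone
import Literature.MathematicalPhysics.QuantumLattice.HubbardTTPrimeEnergyDensityVariationalPrinciple
import Literature.MathematicalPhysics.QuantumLattice.HubbardTTPrimeAnchorWordBoxTransport
import Literature.MathematicalPhysics.QuantumLattice.HubbardNNNHoppingTorusLimitCorrelator
import Literature.MathematicalPhysics.QuantumLattice.InfVolFermionStateDensity
import HarnessLib

/-!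
# Thermodynamic-limit one-sided `U`-derivatives `d₊`, `d₋` of the 2D `t–t'` Hubbard ground-state energy
# density: the double-occupancy RANGE of the translation-invariant ground states (Griffiths / Hellmann–Feynman)

Topic `MathematicalPhysics/QuantumLattice` (family `hubbard`); namespace
`Literature.MathematicalPhysics.QuantumLattice.ThermodynamicLimit`. The `U`-direction twin of
`HubbardChemicalPotentialTL.lean` (there: the one-sided DENSITY derivatives `μ± = chemPot±TT'` of the
convex `n ↦ e(t,t',U,n)`). Here: `U ↦ e(t,t',U,n) = energyDensityTT' t t' U n` is CONCAVE on `[0, ∞)`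
(`concaveOn_energyDensityTT'_U`, Ruelle 1969 §3.3 / Koma–Tasaki 1994 §1: an infimum of functions affine in
`U`) and non-decreasing (`energyDensityTT'_mono_U`), so at every `U > 0` it has one-sided derivatives

* `doccPlusTT' t t' U n  := derivWithin (fun V ↦ e(t,t',V,n)) (Ioi U) U` — `d₊(U) = ∂e/∂U (U⁺)`,
* `doccMinusTT' t t' U n := derivWithin (fun V ↦ e(t,t',V,n)) (Iio U) U` — `d₋(U) = ∂e/∂U (U⁻)`,

with `0 ≤ d₊(U) ≤ d₋(U)`, both antitone in `U`, sandwiching every secant: `slope(U, V) ≤ d₊(U)` (`U < V`),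
`d₋(U) ≤ slope(W, U)` (`0 ≤ W < U`) — hence the ROW-SHAPED forms read from certified energy FLOORS and
CAPS (`doccPlusTT'_ge_of_bounds`: `(lo_V − hi_U)/(V − U) ≤ d₊(U)`; `doccMinusTT'_le_of_bounds`:
`d₋(U) ≤ (hi_U − lo_W)/(U − W)`), exactly the «d(U⁺,n) ≥ · / d(U⁻,n) ≤ ·» columns of the sr-mbsolver MOTT-TABLE.

GRIFFITHS' LEMMA at `T = 0` (Hellmann–Feynman in the thermodynamic limit, no differentiability assumed):
for every translation-invariant state `σ` of density `n ∈ (0,2)` that is a GROUND STATE at `(t,t',U)` — its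
mean energy attains `e(t,t',U,n)` (`e_{Φ(t,t',U)}(σ) ≤ e(t,t',U,n)`; the reverse inequality is the variational
principle `IsTranslationInvariant.energyDensityTT'_le_meanEnergy`) — the double-occupancy density
`D(σ) = e_{Φ(0,0,1)}(σ) = Re σ(n_{0↑}n_{0↓})` lies in `[d₊(U), d₋(U)]`
(`IsTranslationInvariant.doccPlusTT'_le_docc`, `….docc_le_doccMinusTT'`, `….re_expect_docc_mem_Icc_doccPlus_doccMinus`):
the tangent inequality `e(V) ≤ e_{Φ(t,t',V)}(σ) = e(U) + (V − U)·D(σ)` (the mean energy is affine in `U`,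
`meanEnergy_hubbardTTPrime_affine`) bounds the right slopes above and the left slopes below by `D(σ)`, and the
slopes converge to `d±`. At a differentiability point all translation-invariant ground states have the same
double occupancy `= ∂e/∂U` (`IsTranslationInvariant.docc_eq_of_hasDerivAt`). Torus limits of sector ground
states are such states (`IsTorusLimitOf.re_expect_docc_mem_Icc_doccPlus_doccMinus`).

TRANSPORT ALONG THE `U`-RAY (antitone `d±`): a cap on `d₋(U)` bounds `D(σ')` for the TI ground states at every
`U' ≥ U`, a floor on `d₊(U)` bounds it from below at every `0 < U' ≤ U` (`….docc_le_doccMinusTT'_of_le`,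
`….doccPlusTT'_le_docc_of_le`; certified-table forms `….re_expect_docc_le_of_bounds_of_le` / `…_ge_of_bounds_of_le`).

HONEST LIMITS. No value of `d±` is computed here; `U = 0` (boundary of the concavity domain) is excluded
(only `d₊(0)` would make sense); nothing here says the ground state is unique or that `e` is differentiable.
Two definitions with unfolding lemmas; everything else proved; no named fact, no sorry.

## References

* R. B. Griffiths, *A proof that the free energy of a spin system is extensive; Correlation inequalities…*,
  Phys. Rev. 152 (1966) 240, §II (one-sided derivatives of a concave thermodynamic function bound the conjugate
  variable of every equilibrium / ground state). [cite: Griffiths1966, §II]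
* T. Koma, H. Tasaki, J. Stat. Phys. 76 (1994) 745, §1 (ground-state energy concave in a coupling constant;
  `∂E/∂U` = double occupancy where it exists). [cite: KomaTasaki1994, §1]
* D. Ruelle, *Statistical Mechanics: Rigorous Results* (1969), §3.3–§3.4. [cite: Ruelle1969, §3.3]
* E. H. Lieb, F. Y. Wu, Physica A 321 (2003) 1, §7 (the density twin: `μ±` as one-sided derivatives).
  [cite: LiebWuPhysicaA2003, §7]
-/

noncomputable section

namespace Literature.MathematicalPhysics.QuantumLattice

open Set Matrix Finset HubbardWave0 Literature.Probability.LatticeModels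
open _root_.Filter
open scoped _root_.Topology

namespace ThermodynamicLimit

/-! ### The objects -/

/-- **`d₊(U)`, the RIGHT `U`-derivative of the ground-state energy density** `V ↦ energyDensityTT' t t' V n`
at `U` (the double occupancy "just above `U`"; Koma–Tasaki 1994 §1, Griffiths 1966 §II). Meaningful for
`U > 0`, `0 ≤ n < 2` (`hasDerivWithinAt_doccPlusTT'`); junk (Mathlib's default `0`) where the one-sided
derivative does not exist. [cite: KomaTasaki1994, §1] [cite: Griffiths1966, §II] -/
def doccPlusTT' (t t' U n : ℝ) : ℝ :=
  derivWithin (fun V => energyDensityTT' t t' V n) (Ioi U) U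

/-- **`d₋(U)`, the LEFT `U`-derivative of the ground-state energy density** `V ↦ energyDensityTT' t t' V n`
at `U` (the double occupancy "just below `U`"). Meaningful for `U > 0`, `0 ≤ n < 2`
(`hasDerivWithinAt_doccMinusTT'`). [cite: KomaTasaki1994, §1] [cite: Griffiths1966, §II] -/
def doccMinusTT' (t t' U n : ℝ) : ℝ :=
  derivWithin (fun V => energyDensityTT' t t' V n) (Iio U) U

/-- Unfolding lemma for `doccPlusTT'`. [cite: KomaTasaki1994, §1] -/
theorem doccPlusTT'_def (t t' U n : ℝ) :
    doccPlusTT' t t' U n = derivWithin (fun V => energyDensityTT' t t' V n) (Ioi U) U := rfl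

/-- Unfolding lemma for `doccMinusTT'`. [cite: KomaTasaki1994, §1] -/
theorem doccMinusTT'_def (t t' U n : ℝ) :
    doccMinusTT' t t' U n = derivWithin (fun V => energyDensityTT' t t' V n) (Iio U) U := rfl

/-- `t' = 0`: `d₊` is the right `U`-derivative of the square-lattice density `energyDensity2D t · n`.
[cite: KomaTasaki1994, §1] -/
theorem doccPlusTT'_zero (t U n : ℝ) :
    doccPlusTT' t 0 U n = derivWithin (fun V => energyDensity2D t V n) (Ioi U) U := by
  rw [doccPlusTT']
  simp only [energyDensityTT'_zero]

/-- `t' = 0`: `d₋` is the left `U`-derivative of the square-lattice density `energyDensity2D t · n`.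
[cite: KomaTasaki1994, §1] -/
theorem doccMinusTT'_zero (t U n : ℝ) :
    doccMinusTT' t 0 U n = derivWithin (fun V => energyDensity2D t V n) (Iio U) U := by
  rw [doccMinusTT']
  simp only [energyDensityTT'_zero]

/-! ### Existence and ordering of the one-sided derivatives (concavity in `U`) -/

/-- A positive coupling is an interior point of the concavity domain `[0, ∞)`. [folklore] -/
private theorem mem_interior_Ici_zero {U : ℝ} (hU : 0 < U) : U ∈ interior (Ici (0 : ℝ)) := by
  rw [interior_Ici]; exact hU

/-- **`d₊(U)` exists**: `V ↦ e(t,t',V,n)` has right derivative `d₊(U)` at every `U > 0` (`0 ≤ n < 2`; a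
concave function has one-sided derivatives at interior points). [cite: KomaTasaki1994, §1] -/
theorem hasDerivWithinAt_doccPlusTT' (t t' : ℝ) {U : ℝ} (hU : 0 < U) {n : ℝ} (hn0 : 0 ≤ n) (hn2 : n < 2) :
    HasDerivWithinAt (fun V => energyDensityTT' t t' V n) (doccPlusTT' t t' U n) (Ioi U) U := by
  have hc := (concaveOn_energyDensityTT'_U t t' hn0 hn2).neg
  have hR := (hc.differentiableWithinAt_Ioi_of_mem_interior (mem_interior_Ici_zero hU)).neg
  simp only [neg_neg] at hR
  exact hR.hasDerivWithinAt

/-- **`d₋(U)` exists**: `V ↦ e(t,t',V,n)` has left derivative `d₋(U)` at every `U > 0` (`0 ≤ n < 2`).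
[cite: KomaTasaki1994, §1] -/
theorem hasDerivWithinAt_doccMinusTT' (t t' : ℝ) {U : ℝ} (hU : 0 < U) {n : ℝ} (hn0 : 0 ≤ n) (hn2 : n < 2) :
    HasDerivWithinAt (fun V => energyDensityTT' t t' V n) (doccMinusTT' t t' U n) (Iio U) U := by
  have hc := (concaveOn_energyDensityTT'_U t t' hn0 hn2).neg
  have hL := (hc.differentiableWithinAt_Iio_of_mem_interior (mem_interior_Ici_zero hU)).neg
  simp only [neg_neg] at hL
  exact hL.hasDerivWithinAt

/-- **`d₊(U) ≤ d₋(U)`** (`U > 0`, `0 ≤ n < 2`): concavity in `U`. [cite: KomaTasaki1994, §1] -/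
theorem doccPlusTT'_le_doccMinusTT' (t t' : ℝ) {U : ℝ} (hU : 0 < U) {n : ℝ} (hn0 : 0 ≤ n) (hn2 : n < 2) :
    doccPlusTT' t t' U n ≤ doccMinusTT' t t' U n := by
  have hc := (concaveOn_energyDensityTT'_U t t' hn0 hn2).neg
  have key := hc.leftDeriv_le_rightDeriv_of_mem_interior (mem_interior_Ici_zero hU)
  have e1 : (-fun V : ℝ => energyDensityTT' t t' V n) = fun V : ℝ => -energyDensityTT' t t' V n := rfl
  rw [e1, derivWithin.fun_neg, derivWithin.fun_neg] at key
  rw [doccPlusTT', doccMinusTT']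
  linarith

/-- **Right slopes converge to `d₊(U)`**: `slope e U V → d₊(U)` as `V → U⁺`. [cite: KomaTasaki1994, §1] -/
theorem tendsto_slope_nhdsGT_doccPlusTT' (t t' : ℝ) {U : ℝ} (hU : 0 < U) {n : ℝ} (hn0 : 0 ≤ n) (hn2 : n < 2) :
    Tendsto (slope (fun V => energyDensityTT' t t' V n) U) (𝓝[>] U) (𝓝 (doccPlusTT' t t' U n)) :=
  (hasDerivWithinAt_iff_tendsto_slope' self_notMem_Ioi).1 (hasDerivWithinAt_doccPlusTT' t t' hU hn0 hn2)

/-- **Left slopes converge to `d₋(U)`**: `slope e U W → d₋(U)` as `W → U⁻`. [cite: KomaTasaki1994, §1] -/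
theorem tendsto_slope_nhdsLT_doccMinusTT' (t t' : ℝ) {U : ℝ} (hU : 0 < U) {n : ℝ} (hn0 : 0 ≤ n) (hn2 : n < 2) :
    Tendsto (slope (fun V => energyDensityTT' t t' V n) U) (𝓝[<] U) (𝓝 (doccMinusTT' t t' U n)) :=
  (hasDerivWithinAt_iff_tendsto_slope' self_notMem_Iio).1 (hasDerivWithinAt_doccMinusTT' t t' hU hn0 hn2)

/-! ### Secant bounds -/

/-- **Forward secant ≤ `d₊`**: `(e(V) − e(U))/(V − U) ≤ d₊(U)` for `0 < U < V` (the right derivative of a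
concave function dominates every secant slope to the right). [cite: KomaTasaki1994, §1] -/
theorem slope_le_doccPlusTT' (t t' : ℝ) {U V : ℝ} (hU : 0 < U) (hUV : U < V) {n : ℝ} (hn0 : 0 ≤ n)
    (hn2 : n < 2) :
    (energyDensityTT' t t' V n - energyDensityTT' t t' U n) / (V - U) ≤ doccPlusTT' t t' U n := by
  have h := (concaveOn_energyDensityTT'_U t t' hn0 hn2).slope_le_of_hasDerivWithinAt_Ioi
    (show U ∈ Ici (0 : ℝ) from hU.le) (show V ∈ Ici (0 : ℝ) from (hU.trans hUV).le) hUV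
    (hasDerivWithinAt_doccPlusTT' t t' hU hn0 hn2)
  rwa [slope_def_field] at h

/-- **`d₋` ≤ backward secant**: `d₋(U) ≤ (e(U) − e(W))/(U − W)` for `0 ≤ W < U` (the left derivative of a
concave function is dominated by every secant slope to the left). [cite: KomaTasaki1994, §1] -/
theorem doccMinusTT'_le_slope (t t' : ℝ) {W U : ℝ} (hW : 0 ≤ W) (hWU : W < U) {n : ℝ} (hn0 : 0 ≤ n)
    (hn2 : n < 2) :
    doccMinusTT' t t' U n ≤ (energyDensityTT' t t' U n - energyDensityTT' t t' W n) / (U - W) := by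
  have h := (concaveOn_energyDensityTT'_U t t' hn0 hn2).le_slope_of_hasDerivWithinAt_Iio
    (show W ∈ Ici (0 : ℝ) from hW) (show U ∈ Ici (0 : ℝ) from (hW.trans_lt hWU).le) hWU
    (hasDerivWithinAt_doccMinusTT' t t' (hW.trans_lt hWU) hn0 hn2)
  rwa [slope_def_field] at h

/-- **`d₋(U) ≤ d₊(W)` for `0 < W < U`** (both sandwich the secant over `[W, U]`): the double occupancy is
non-increasing across couplings. [cite: KomaTasaki1994, §1] -/
theorem doccMinusTT'_le_doccPlusTT'_of_lt (t t' : ℝ) {W U : ℝ} (hW : 0 < W) (hWU : W < U) {n : ℝ}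
    (hn0 : 0 ≤ n) (hn2 : n < 2) :
    doccMinusTT' t t' U n ≤ doccPlusTT' t t' W n :=
  (doccMinusTT'_le_slope t t' hW.le hWU hn0 hn2).trans (slope_le_doccPlusTT' t t' hW hWU hn0 hn2)

/-- **`0 ≤ d₊(U)`** (`U > 0`): `e` is non-decreasing in `U` (`energyDensityTT'_mono_U`), so every forward
secant is `≥ 0`. [cite: KomaTasaki1994, §1] -/
theorem doccPlusTT'_nonneg (t t' : ℝ) {U : ℝ} (hU : 0 < U) {n : ℝ} (hn0 : 0 ≤ n) (hn2 : n < 2) :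
    0 ≤ doccPlusTT' t t' U n := by
  refine le_trans ?_ (slope_le_doccPlusTT' t t' hU (lt_add_one U) hn0 hn2)
  exact div_nonneg (sub_nonneg.2 (energyDensityTT'_mono_U t t' hn0 hn2 hU.le (le_add_of_nonneg_right zero_le_one)))
    (by linarith)

/-- **`0 ≤ d₋(U)`** (`U > 0`). [cite: KomaTasaki1994, §1] -/
theorem doccMinusTT'_nonneg (t t' : ℝ) {U : ℝ} (hU : 0 < U) {n : ℝ} (hn0 : 0 ≤ n) (hn2 : n < 2) :
    0 ≤ doccMinusTT' t t' U n :=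
  (doccPlusTT'_nonneg t t' hU hn0 hn2).trans (doccPlusTT'_le_doccMinusTT' t t' hU hn0 hn2)

/-! ### Row-shaped corollaries: `d±` from certified energy floors and caps -/

/-- **`d₊` FLOOR from an energy CAP at `U` and an energy FLOOR at `V > U`**: `e(U) ≤ hi`, `lo ≤ e(V)`
(`0 < U < V`, `0 ≤ n < 2`) give `(lo − hi)/(V − U) ≤ d₊(U)`. (E.g. the cell-certified rows of
`Summits/Ventures/CertifiedManyBodySolver`; no certificate is read here.) [cite: Griffiths1966, §II] -/
theorem doccPlusTT'_ge_of_bounds (t t' : ℝ) {U V hi lo : ℝ} (hU : 0 < U) (hUV : U < V) {n : ℝ} (hn0 : 0 ≤ n)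
    (hn2 : n < 2) (hhi : energyDensityTT' t t' U n ≤ hi) (hlo : lo ≤ energyDensityTT' t t' V n) :
    (lo - hi) / (V - U) ≤ doccPlusTT' t t' U n := by
  refine le_trans ?_ (slope_le_doccPlusTT' t t' hU hUV hn0 hn2)
  exact div_le_div_of_nonneg_right (by linarith) (by linarith)

/-- **`d₋` FLOOR** from the same data (`d₊ ≤ d₋`): `(lo − hi)/(V − U) ≤ d₋(U)`. [cite: Griffiths1966, §II] -/
theorem doccMinusTT'_ge_of_bounds (t t' : ℝ) {U V hi lo : ℝ} (hU : 0 < U) (hUV : U < V) {n : ℝ} (hn0 : 0 ≤ n)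
    (hn2 : n < 2) (hhi : energyDensityTT' t t' U n ≤ hi) (hlo : lo ≤ energyDensityTT' t t' V n) :
    (lo - hi) / (V - U) ≤ doccMinusTT' t t' U n :=
  (doccPlusTT'_ge_of_bounds t t' hU hUV hn0 hn2 hhi hlo).trans (doccPlusTT'_le_doccMinusTT' t t' hU hn0 hn2)

/-- **`d₋` CEILING from an energy CAP at `U` and an energy FLOOR at `W < U`**: `e(U) ≤ hi`, `lo ≤ e(W)`
(`0 ≤ W < U`, `0 ≤ n < 2`) give `d₋(U) ≤ (hi − lo)/(U − W)`. [cite: Griffiths1966, §II] -/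
theorem doccMinusTT'_le_of_bounds (t t' : ℝ) {W U hi lo : ℝ} (hW : 0 ≤ W) (hWU : W < U) {n : ℝ} (hn0 : 0 ≤ n)
    (hn2 : n < 2) (hhi : energyDensityTT' t t' U n ≤ hi) (hlo : lo ≤ energyDensityTT' t t' W n) :
    doccMinusTT' t t' U n ≤ (hi - lo) / (U - W) := by
  refine (doccMinusTT'_le_slope t t' hW hWU hn0 hn2).trans ?_
  exact div_le_div_of_nonneg_right (by linarith) (by linarith)

/-- **`d₊` CEILING** from the same data (`d₊ ≤ d₋`): `d₊(U) ≤ (hi − lo)/(U − W)`. [cite: Griffiths1966, §II] -/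
theorem doccPlusTT'_le_of_bounds (t t' : ℝ) {W U hi lo : ℝ} (hW : 0 ≤ W) (hWU : W < U) {n : ℝ} (hn0 : 0 ≤ n)
    (hn2 : n < 2) (hhi : energyDensityTT' t t' U n ≤ hi) (hlo : lo ≤ energyDensityTT' t t' W n) :
    doccPlusTT' t t' U n ≤ (hi - lo) / (U - W) :=
  (doccPlusTT'_le_doccMinusTT' t t' (hW.trans_lt hWU) hn0 hn2).trans
    (doccMinusTT'_le_of_bounds t t' hW hWU hn0 hn2 hhi hlo)

end ThermodynamicLimit

/-! ### Griffiths' lemma: the double occupancy of a translation-invariant ground state lies in `[d₊, d₋]` -/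

namespace InfVolFermionState

open ThermodynamicLimit

variable {σ : InfVolFermionState 2}

/-- **Tangent inequality.** A translation-invariant `σ` of density `ρ ∈ (0,2)` which is a ground state at
`(t,t',U)` (`e_{Φ(t,t',U)}(σ) ≤ e(t,t',U,ρ)`) satisfies, at every `V ≥ 0`,
`e(t,t',V,ρ) ≤ e(t,t',U,ρ) + (V − U)·D(σ)` (variational principle at `V` + affinity of the mean energy in `U`).
[cite: Griffiths1966, §II] [cite: KomaTasaki1994, §1] -/
theorem IsTranslationInvariant.energyDensityTT'_le_add_mul_docc_of_groundState (hσ : σ.IsTranslationInvariant)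
    (t t' : ℝ) {U V : ℝ} (hV : 0 ≤ V) (hρ0 : 0 < σ.density) (hρ2 : σ.density < 2)
    (hgs : σ.meanEnergy (hubbardTTPrimeFermionInteraction t t' U) 1 ≤ energyDensityTT' t t' U σ.density) :
    energyDensityTT' t t' V σ.density ≤
      energyDensityTT' t t' U σ.density + (V - U) * σ.meanEnergy (hubbardTTPrimeFermionInteraction 0 0 1) 1 := by
  have hvar := hσ.energyDensityTT'_le_meanEnergy t t' hV hρ0 hρ2
  have haff := σ.meanEnergy_hubbardTTPrime_affine t t' U t' V
  rw [sub_self, zero_mul, add_zero] at haff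
  linarith

/-- **`d₊(U) ≤ D(σ)`** for every translation-invariant ground state `σ` of density `ρ ∈ (0,2)` at `(t,t',U)`,
`U > 0`: the right slopes of the concave `e(·,ρ)` at `U` are `≤ D(σ)` and converge to `d₊(U)`.
[cite: Griffiths1966, §II] -/
theorem IsTranslationInvariant.doccPlusTT'_le_docc (hσ : σ.IsTranslationInvariant) (t t' : ℝ) {U : ℝ}
    (hU : 0 < U) (hρ0 : 0 < σ.density) (hρ2 : σ.density < 2)
    (hgs : σ.meanEnergy (hubbardTTPrimeFermionInteraction t t' U) 1 ≤ energyDensityTT' t t' U σ.density) :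
    doccPlusTT' t t' U σ.density ≤ σ.meanEnergy (hubbardTTPrimeFermionInteraction 0 0 1) 1 := by
  refine le_of_tendsto (tendsto_slope_nhdsGT_doccPlusTT' t t' hU hρ0.le hρ2)
    (eventually_nhdsWithin_of_forall fun V hV => ?_)
  have hUV : U < V := hV
  have key := hσ.energyDensityTT'_le_add_mul_docc_of_groundState t t' (hU.trans hUV).le hρ0 hρ2 hgs
  rw [slope_def_field, div_le_iff₀ (sub_pos.2 hUV)]
  linarith

/-- **`D(σ) ≤ d₋(U)`** for every translation-invariant ground state `σ` of density `ρ ∈ (0,2)` at `(t,t',U)`,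
`U > 0`: the left slopes of `e(·,ρ)` at `U` (from couplings `W ∈ (0, U)`) are `≥ D(σ)` and converge to `d₋(U)`.
[cite: Griffiths1966, §II] -/
theorem IsTranslationInvariant.docc_le_doccMinusTT' (hσ : σ.IsTranslationInvariant) (t t' : ℝ) {U : ℝ}
    (hU : 0 < U) (hρ0 : 0 < σ.density) (hρ2 : σ.density < 2)
    (hgs : σ.meanEnergy (hubbardTTPrimeFermionInteraction t t' U) 1 ≤ energyDensityTT' t t' U σ.density) :
    σ.meanEnergy (hubbardTTPrimeFermionInteraction 0 0 1) 1 ≤ doccMinusTT' t t' U σ.density := by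
  refine ge_of_tendsto (tendsto_slope_nhdsLT_doccMinusTT' t t' hU hρ0.le hρ2) ?_
  filter_upwards [Ioo_mem_nhdsLT hU] with W hW
  have hWU : W < U := hW.2
  have key := hσ.energyDensityTT'_le_add_mul_docc_of_groundState t t' hW.1.le hρ0 hρ2 hgs
  rw [slope_comm, slope_def_field, le_div_iff₀ (sub_pos.2 hWU)]
  nlinarith

/-- **GRIFFITHS' BRACKET**: `D(σ) ∈ [d₊(U), d₋(U)]` for every translation-invariant ground state `σ` of density
`ρ ∈ (0,2)` at `(t,t',U)`, `U > 0`. [cite: Griffiths1966, §II] [cite: KomaTasaki1994, §1] -/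
theorem IsTranslationInvariant.docc_mem_Icc_doccPlus_doccMinus (hσ : σ.IsTranslationInvariant) (t t' : ℝ)
    {U : ℝ} (hU : 0 < U) (hρ0 : 0 < σ.density) (hρ2 : σ.density < 2)
    (hgs : σ.meanEnergy (hubbardTTPrimeFermionInteraction t t' U) 1 ≤ energyDensityTT' t t' U σ.density) :
    σ.meanEnergy (hubbardTTPrimeFermionInteraction 0 0 1) 1 ∈
      Icc (doccPlusTT' t t' U σ.density) (doccMinusTT' t t' U σ.density) :=
  ⟨hσ.doccPlusTT'_le_docc t t' hU hρ0 hρ2 hgs, hσ.docc_le_doccMinusTT' t t' hU hρ0 hρ2 hgs⟩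

/-- **The same bracket for the local double occupancy `Re σ(n_{0↑}n_{0↓})`** (`= D(σ)` for every state,
`meanEnergy_hubbardTTPrime_onSite_eq_re_expect_docc`). [cite: Griffiths1966, §II] -/
theorem IsTranslationInvariant.re_expect_docc_mem_Icc_doccPlus_doccMinus (hσ : σ.IsTranslationInvariant)
    (t t' : ℝ) {U : ℝ} (hU : 0 < U) (hρ0 : 0 < σ.density) (hρ2 : σ.density < 2)
    (hgs : σ.meanEnergy (hubbardTTPrimeFermionInteraction t t' U) 1 ≤ energyDensityTT' t t' U σ.density) :
    (σ.expect ({0} : Finset (Site 2))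
        (nAt 0 (Finset.mem_singleton_self 0) 0 * nAt 0 (Finset.mem_singleton_self 0) 1)).re ∈
      Icc (doccPlusTT' t t' U σ.density) (doccMinusTT' t t' U σ.density) := by
  rw [← σ.meanEnergy_hubbardTTPrime_onSite_eq_re_expect_docc]
  exact hσ.docc_mem_Icc_doccPlus_doccMinus t t' hU hρ0 hρ2 hgs

/-- **HELLMANN–FEYNMAN at a differentiability point**: if `V ↦ e(t,t',V,ρ)` has derivative `f'` at `U > 0`,
every translation-invariant ground state of density `ρ` at `(t,t',U)` has double occupancy `D(σ) = f'`
(all ground states agree off the kinks). [cite: Griffiths1966, §II] [cite: KomaTasaki1994, §1] -/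
theorem IsTranslationInvariant.docc_eq_of_hasDerivAt (hσ : σ.IsTranslationInvariant) (t t' : ℝ) {U : ℝ}
    (hU : 0 < U) (hρ0 : 0 < σ.density) (hρ2 : σ.density < 2)
    (hgs : σ.meanEnergy (hubbardTTPrimeFermionInteraction t t' U) 1 ≤ energyDensityTT' t t' U σ.density)
    {f' : ℝ} (hf : HasDerivAt (fun V => energyDensityTT' t t' V σ.density) f' U) :
    σ.meanEnergy (hubbardTTPrimeFermionInteraction 0 0 1) 1 = f' := by
  have hP : doccPlusTT' t t' U σ.density = f' := by
    rw [doccPlusTT']; exact hf.hasDerivWithinAt.derivWithin (uniqueDiffWithinAt_Ioi U)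
  have hM : doccMinusTT' t t' U σ.density = f' := by
    rw [doccMinusTT']; exact hf.hasDerivWithinAt.derivWithin (uniqueDiffWithinAt_Iio U)
  have h := hσ.docc_mem_Icc_doccPlus_doccMinus t t' hU hρ0 hρ2 hgs
  rw [hP, hM] at h
  exact le_antisymm h.2 h.1

/-- **Torus limits of sector ground states**: for `U > 0`, `0 < n < 2`, a torus limit `ω` along `Ls → ∞` of
unit ground states of `hubbardTorusTT' (Ls j) t t' U` in the sectors `(rectN n (Ls j), S^z = 0)` is a
translation-invariant ground state of density `n`, so `Re ω(n_{0↑}n_{0↓}) ∈ [d₊(U), d₋(U)]` at `(t,t',U,n)`.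
[cite: Griffiths1966, §II] [cite: Ruelle1969, §3.3] -/
theorem IsTorusLimitOf.re_expect_docc_mem_Icc_doccPlus_doccMinus (t t' : ℝ) {U : ℝ} (hU : 0 < U) {n : ℝ}
    (hn0 : 0 < n) (hn2 : n < 2)
    {ω : InfVolFermionState 2} {ψ : ∀ L, Fock (Orb (FermionTorus 2 L))} {Ls : ℕ → ℕ}
    (h : ω.IsTorusLimitOf ψ Ls) (hLs : Tendsto Ls atTop atTop)
    (hψ : ∀ j, IsGroundStateInSector (hubbardTorusTT' (Ls j) t t' U) (rectN n (Ls j)) 0 (ψ (Ls j)))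
    (h1 : ∀ j, star (ψ (Ls j)) ⬝ᵥ ψ (Ls j) = 1) :
    (ω.expect ({0} : Finset (Site 2))
        (nAt 0 (Finset.mem_singleton_self 0) 0 * nAt 0 (Finset.mem_singleton_self 0) 1)).re ∈
      Icc (doccPlusTT' t t' U n) (doccMinusTT' t t' U n) := by
  have hN : ∀ j, IsNParticle (rectN n (Ls j)) (ψ (Ls j)) := fun j =>
    ((mem_szSector_iff _ _ _).1 (hψ j).1).1
  have hρ : ω.density = n := h.density_eq_of_rectN hLs hn0.le hN h1
  have hE := h.meanEnergy_hubbardTTPrime_eq_energyDensityTT' t t' hU.le hn0.le hn2 hLs hψ h1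
  have key := h.isTranslationInvariant.re_expect_docc_mem_Icc_doccPlus_doccMinus t t' hU
    (by rw [hρ]; exact hn0) (by rw [hρ]; exact hn2) (by rw [hρ, hE])
  rwa [hρ] at key

/-! ### Transport along the `U`-ray: a cap at `U` holds on `[U, ∞)`, a floor at `U` holds on `(0, U]` -/

/-- **`D(σ') ≤ d₋(U)` for every translation-invariant ground state `σ'` at ANY coupling `U' ≥ U`** (`U > 0`,
density `ρ ∈ (0,2)`): `D(σ') ≤ d₋(U') ≤ d₊(U) ≤ d₋(U)` for `U < U'` (the one-sided derivatives are antitone), and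
Griffiths' bracket at `U' = U`. A cap certified on `d₋(U)` therefore bounds the double occupancy of every
translation-invariant ground state on the whole ray `[U, ∞)`. [cite: Griffiths1966, §II] [cite: KomaTasaki1994, §1] -/
theorem IsTranslationInvariant.docc_le_doccMinusTT'_of_le (hσ : σ.IsTranslationInvariant) (t t' : ℝ) {U U' : ℝ}
    (hU : 0 < U) (hUU' : U ≤ U') (hρ0 : 0 < σ.density) (hρ2 : σ.density < 2)
    (hgs : σ.meanEnergy (hubbardTTPrimeFermionInteraction t t' U') 1 ≤ energyDensityTT' t t' U' σ.density) :
    σ.meanEnergy (hubbardTTPrimeFermionInteraction 0 0 1) 1 ≤ doccMinusTT' t t' U σ.density := by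
  have h1 := hσ.docc_le_doccMinusTT' t t' (hU.trans_le hUU') hρ0 hρ2 hgs
  rcases eq_or_lt_of_le hUU' with h | h
  · rw [h]; exact h1
  · exact h1.trans ((doccMinusTT'_le_doccPlusTT'_of_lt t t' hU h hρ0.le hρ2).trans
      (doccPlusTT'_le_doccMinusTT' t t' hU hρ0.le hρ2))

/-- **`d₊(U) ≤ D(σ')` for every translation-invariant ground state `σ'` at ANY coupling `0 < U' ≤ U`**:
`d₊(U) ≤ d₋(U) ≤ d₊(U') ≤ D(σ')` for `U' < U`. A floor certified on `d₊(U)` bounds the double occupancy of every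
translation-invariant ground state on `(0, U]` from below. [cite: Griffiths1966, §II] [cite: KomaTasaki1994, §1] -/
theorem IsTranslationInvariant.doccPlusTT'_le_docc_of_le (hσ : σ.IsTranslationInvariant) (t t' : ℝ) {U U' : ℝ}
    (hU' : 0 < U') (hU'U : U' ≤ U) (hρ0 : 0 < σ.density) (hρ2 : σ.density < 2)
    (hgs : σ.meanEnergy (hubbardTTPrimeFermionInteraction t t' U') 1 ≤ energyDensityTT' t t' U' σ.density) :
    doccPlusTT' t t' U σ.density ≤ σ.meanEnergy (hubbardTTPrimeFermionInteraction 0 0 1) 1 := by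
  have h1 := hσ.doccPlusTT'_le_docc t t' hU' hρ0 hρ2 hgs
  rcases eq_or_lt_of_le hU'U with h | h
  · rw [← h]; exact h1
  · exact ((doccPlusTT'_le_doccMinusTT' t t' (hU'.trans h) hρ0.le hρ2).trans
      (doccMinusTT'_le_doccPlusTT'_of_lt t t' hU' h hρ0.le hρ2)).trans h1

/-- **RAY CAP from the certified table**: a CAP `e(t,t',U,ρ) ≤ hi` and a FLOOR `lo ≤ e(t,t',W,ρ)` at `0 ≤ W < U`
give `Re σ'(n_{0↑}n_{0↓}) ≤ (hi − lo)/(U − W)` for every translation-invariant ground state `σ'` of density `ρ`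
at EVERY coupling `U' ≥ U` (the chord cap at `U` transported up the ray). [cite: Griffiths1966, §II] -/
theorem IsTranslationInvariant.re_expect_docc_le_of_bounds_of_le (hσ : σ.IsTranslationInvariant) (t t' : ℝ)
    {W U U' hi lo : ℝ} (hW : 0 ≤ W) (hWU : W < U) (hUU' : U ≤ U') (hρ0 : 0 < σ.density) (hρ2 : σ.density < 2)
    (hhi : energyDensityTT' t t' U σ.density ≤ hi) (hlo : lo ≤ energyDensityTT' t t' W σ.density)
    (hgs : σ.meanEnergy (hubbardTTPrimeFermionInteraction t t' U') 1 ≤ energyDensityTT' t t' U' σ.density) :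
    (σ.expect ({0} : Finset (Site 2))
        (nAt 0 (Finset.mem_singleton_self 0) 0 * nAt 0 (Finset.mem_singleton_self 0) 1)).re ≤ (hi - lo) / (U - W) := by
  rw [← σ.meanEnergy_hubbardTTPrime_onSite_eq_re_expect_docc]
  exact (hσ.docc_le_doccMinusTT'_of_le t t' (hW.trans_lt hWU) hUU' hρ0 hρ2 hgs).trans
    (doccMinusTT'_le_of_bounds t t' hW hWU hρ0.le hρ2 hhi hlo)

/-- **RAY FLOOR from the certified table**: a CAP `e(t,t',U,ρ) ≤ hi` and a FLOOR `lo ≤ e(t,t',V,ρ)` at `V > U > 0`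
give `(lo − hi)/(V − U) ≤ Re σ'(n_{0↑}n_{0↓})` for every translation-invariant ground state `σ'` of density `ρ`
at EVERY coupling `0 < U' ≤ U`. [cite: Griffiths1966, §II] -/
theorem IsTranslationInvariant.re_expect_docc_ge_of_bounds_of_le (hσ : σ.IsTranslationInvariant) (t t' : ℝ)
    {U U' V hi lo : ℝ} (hU' : 0 < U') (hU'U : U' ≤ U) (hUV : U < V) (hρ0 : 0 < σ.density) (hρ2 : σ.density < 2)
    (hhi : energyDensityTT' t t' U σ.density ≤ hi) (hlo : lo ≤ energyDensityTT' t t' V σ.density)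
    (hgs : σ.meanEnergy (hubbardTTPrimeFermionInteraction t t' U') 1 ≤ energyDensityTT' t t' U' σ.density) :
    (lo - hi) / (V - U) ≤ (σ.expect ({0} : Finset (Site 2))
        (nAt 0 (Finset.mem_singleton_self 0) 0 * nAt 0 (Finset.mem_singleton_self 0) 1)).re := by
  rw [← σ.meanEnergy_hubbardTTPrime_onSite_eq_re_expect_docc]
  exact (doccPlusTT'_ge_of_bounds t t' (hU'.trans_le hU'U) hUV hρ0.le hρ2 hhi hlo).trans
    (hσ.doccPlusTT'_le_docc_of_le t t' hU' hU'U hρ0 hρ2 hgs)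

end InfVolFermionState

end Literature.MathematicalPhysics.QuantumLattice

end
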